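import Summits.HodgeConjecture.HodgeConjecture.Theorems.SiegelUniversalFamilyCupFrameIndependent   -- ★ (I) p731817: §1 generic `linearIndependent_cupProduct_ofRatClass_of_map_eq_latticeClass`
import Literature.AlgebraicGeometry.HodgeTheory.MotivatedClassesDeformation                         -- ★ `Motives.familyPullback`, `Motives.fiberOverFamilyPullbackIso`
import HarnessLib

/-!
# The ordered cup frame of a lattice frame is independent — PIECE edition (fibres of the universal family pulled back along an open piece)

Sub-problem `HodgeConjecture` (cell HC_CM, E-road «EQUIDIM BY PROOF», the OPEN-PIECE edition of the (U)-lane node P4: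
P4 lead B-p03 (g14)'s piece-sockets v1 `PieceSockets.v1.B-p03g14.lean` dbc741d75091438d, ASSEMBLER SOCKET (I-piece)
`UHead.Ue_N3asm_cupFrameIndependent_piece` :1324, text verbatim).  The (I) socket of the N3-core assembler re-threaded along
an open piece `ι : S′ ⟶ 𝓜 ⊗_ℚ ℂ`: the fibre is now a fibre of `Motives.familyPullback.snd (W1.univFamilyℂ 𝓜) ι` at
`y : S′(ℂ)`, identified with `A_y(ℂ)` through the pinned isomorphism extended by ★ `Motives.fiberOverFamilyPullbackIso`.
The proof is the SAME generic torus bookkeeping as ★ (I) p731817 (`UnivFamilyCupFrame.linearIndependent_cupProduct_ofRatClass_of_map_eq_latticeClass`,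
[Lange2023AbelianVarietiesComplex] §1.1.3 Lemma 1.1.17 (a), §1.1.4 Prop. 1.1.20: `H^*(torus) = ⋀^* H¹`, the cup product is the
exterior product), which is stated for an ARBITRARY continuous map `ψ : X → Y` from the uniformising torus — here
`ψ = (e_y ∘ φ)` with the longer pinned `e_y`.  Main result: `ue_N3asm_cupFrameIndependent_piece_holds`.
HC_CM is proved only modulo the 7 printed citations until rung 0 closes; this helper is unconditional and count-neutral.

## References
* [Lange2023AbelianVarietiesComplex] H. Lange, *Abelian Varieties over the Complex Numbers*, Springer 2023, §1.1.3 Lemma 1.1.17 (a) (p. 14), §1.1.4 Prop. 1.1.20 (p. 15).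
* [HatcherAT2002] A. Hatcher, *Algebraic Topology*, §3.2 Prop. 3.10 (naturality of the cup product).
-/

set_option autoImplicit false
set_option linter.dupNamespace false

noncomputable section

-- `ComplexTorus Φ'` (for `Φ' : ℝⁿ ≃ E`) is the type `Torus n = (ℝ/ℤ)ⁿ`; instance paths up to unfolding (as in ★ (I) p731817)
set_option backward.isDefEq.respectTransparency false

open CategoryTheory CategoryTheory.Limits AlgebraicGeometry Matrix Topology
open Literature.AlgebraicGeometry
open Literature.AlgebraicGeometry.Motives (SchemeOver ComplexPoints AlgPoints specOver AbelianVariety CartierDivisor fiberOver)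
open Literature.AlgebraicGeometry.HodgeTheory (ofRatClass latticeClass)
open Literature.AlgebraicGeometry.AbelianSchemes (PolarizedAbelianSchemeWithLevel AbelianSchemeOver)
open Literature.AlgebraicGeometry.ModuliOfAbelianVarieties
open Literature.AlgebraicGeometry.ModuliOfAbelianVarieties.SiegelModuli
open Literature.Geometry.Kaehler (ComplexTorus)
open Literature.NumberTheory.Transcendental (IsAnalytification)
open Literature.AlgebraicTopology.SingularHomology

namespace Summit.HodgeConjecture.HodgeConjecture.Theorems

namespace UnivFamilyCupFrame

/-- **ASSEMBLER SOCKET (I-piece) «THE ORDERED CUP FRAME OF A LATTICE FRAME IS INDEPENDENT», OPEN-PIECE EDITION — discharged.**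
For a fibre `X_y` of the universal family pulled back along an open piece `ι : S′ ⟶ 𝓜 ⊗_ℚ ℂ` (`Motives.familyPullback.snd
(W1.univFamilyℂ 𝓜) ι`, `y : S′(ℂ)`), identified with `A_y(ℂ)` through the pinned isomorphism
`fibreAVIso ≪≫ (fiberUnivIsoOfIsBaseChangeVia …)⁻¹ ≪≫ (fiberOverFamilyPullbackIso …)⁻¹` and uniformised by
`φ : ℂ^g/Φ(ℤ^{2g}) → A_y(ℂ)` with `(e_y ∘ φ)^* (γ a) = ξ_a`, the classes `(γ a ⊗ 1) ⌣ (γ b ⊗ 1)`, `a < b` in the order of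
`Fin (g+g)` through `finSumFinEquiv`, are `ℂ`-linearly independent in `H²(X_y(ℂ); ℂ)` — ★ (I) §1 with `ψ = e_y ∘ φ`,
`e = finSumFinEquiv`.  Statement = the socket text of piece-sockets v1 :1324 verbatim.
[cite: Lange2023AbelianVarietiesComplex, §1.1.3 Lemma 1.1.17 (a) (p. 14)] [cite: Lange2023AbelianVarietiesComplex, §1.1.4 Prop. 1.1.20]
[cite: HatcherAT2002, §3.2 Prop. 3.10] -/
theorem ue_N3asm_cupFrameIndependent_piece_holds :
    ∀ (g N : ℕ) (δ : Fin g → ℕ) (_hg : 0 < g) (_hδ : IsPolarizationType δ) (_hN : 3 ≤ N)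
      (𝓜 : SiegelFineModuliScheme g N δ) {S' : SchemeOver ℂ} (ι : S' ⟶ (Motives.baseChange ℚ ℂ).obj 𝓜.M),
      haveI : IsLocallyNoetherian (specOver ℚ ℂ).left :=
        inferInstanceAs (IsLocallyNoetherian (Spec (CommRingCat.of ℂ)))
      ∀ (y : ComplexPoints S')
        (P' : PolarizedAbelianSchemeWithLevel g N δ (specOver ℚ ℂ).left)
        (G : P'.A.X.left ⟶ 𝓜.univ.A.X.left) (Ĝ : P'.D.hat.X.left ⟶ 𝓜.univ.D.hat.X.left)
        (hbc : P'.IsBaseChangeVia 𝓜.univ ((AlgPoints.baseChangeEquiv (algebraMap ℚ ℂ) 𝓜.M).symm (AlgPoints.map (L := ℂ) ι y)).left G Ĝ)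
        (γ : Fin g ⊕ Fin g → singularCohomology ℚ ℚ (ComplexPoints (fiberOver (Motives.familyPullback.snd (W1.univFamilyℂ 𝓜) ι) y)) 1)
        (Φ : (Fin g ⊕ Fin g → ℝ) ≃L[ℝ] (Fin g → ℂ))
        (φ : C(ComplexTorus Φ, (P'.A.fibre (𝟙 (Spec (CommRingCat.of ℂ)))).toAbelianVariety.Points ℂ)),
        IsAnalytification (Fin g → ℂ) (P'.A.fibre (𝟙 (Spec (CommRingCat.of ℂ)))).toAbelianVariety.X
          (P'.A.fibre (𝟙 (Spec (CommRingCat.of ℂ)))).toAbelianVariety.dim φ →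
        (∀ a : Fin g ⊕ Fin g,
          singularCohomology.map ℚ ℚ
              (((Motives.AlgPoints.homeomorphOfIso (L := ℂ)
                  (W1.fibreAVIso P' ≪≫ (W1.fiberUnivIsoOfIsBaseChangeVia 𝓜 (AlgPoints.map (L := ℂ) ι y) P' G Ĝ hbc).symm ≪≫
                    (Motives.fiberOverFamilyPullbackIso (W1.univFamilyℂ 𝓜) ι y).symm) :
                  (P'.A.fibre (𝟙 (Spec (CommRingCat.of ℂ)))).toAbelianVariety.Points ℂ ≃ₜ
                    ComplexPoints (fiberOver (Motives.familyPullback.snd (W1.univFamilyℂ 𝓜) ι) y)) :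
                C((P'.A.fibre (𝟙 (Spec (CommRingCat.of ℂ)))).toAbelianVariety.Points ℂ,
                  ComplexPoints (fiberOver (Motives.familyPullback.snd (W1.univFamilyℂ 𝓜) ι) y))).comp φ) 1 (γ a) =
            HodgeTheory.latticeClass Φ a) →
        LinearIndependent ℂ fun j : {ab : (Fin g ⊕ Fin g) × (Fin g ⊕ Fin g) //
            (finSumFinEquiv ab.1 : Fin (g + g)) < finSumFinEquiv ab.2} ↦
          cupProduct (show 1 + 1 = 2 from rfl) (ofRatClass _ 1 (γ j.1.1)) (ofRatClass _ 1 (γ j.1.2)) := by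
  intro g N δ _hg _hδ _hN 𝓜 S' ι y P' G Ĝ hbc γ Φ φ _hφ hframe
  exact linearIndependent_cupProduct_ofRatClass_of_map_eq_latticeClass Φ finSumFinEquiv _ γ hframe

end UnivFamilyCupFrame

end Summit.HodgeConjecture.HodgeConjecture.Theorems

end
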